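import Literature.Computability.ImplicitComplexity.STAEncBasics
import HarnessLib

/-!
# Typed combinators for `STA` programs, II: multi-β and iterated application

Support file for the `PTIME` completeness half of `STACapturesP` (GMR08 Thm. 3.9), continuing
`STAEncBasics.lean`:

* `reduces_apps_lams` — **multi-β**: `(λx₁…xₙ.R) M₁ ⋯ Mₙ →β* R[M₁,…,Mₙ]` in de Bruijn form
  (the substitution `Term.subL`, with `Term.up_iterate_subL` for its lifts under binders) — the
  workhorse behind every reduction lemma of the simulation of GMR08 Thm. 3.9;
* `iterApp F Z n ≐ F (F (⋯ (F Z)))`, `Reduces.lams`, and the closedness of word data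
  `encWord_closed`.

## References

* [GaboardiMarionRonchidellarocca2008] GMR08, §3.2, Thm. 3.9.
-/

namespace Literature.Computability.ImplicitComplexity

namespace STA

/-! ### Multi-β -/

/-- The substitution performed by `(λx₁…xₙ.R) M₁ ⋯ Mₙ`: `x₁` (the outermost binder, de Bruijn
index `n-1` in `R`) receives `M₁`, …, `xₙ` (index `0`) receives `Mₙ`; higher indices drop by `n`.
[folklore] -/
def Term.subL (Ms : List Term) (i : ℕ) : Term :=
  if h : i < Ms.length then Ms.get ⟨Ms.length - 1 - i, by omega⟩ else .var (i - Ms.length)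

/-- `subL []` is the identity substitution. [folklore] -/
theorem Term.subL_nil (i : ℕ) : Term.subL [] i = .var i := by simp [Term.subL]

/-- `subL` of a cons, below the new binder count. [folklore] -/
theorem Term.subL_cons (M : Term) (Ms : List Term) (i : ℕ) :
    Term.subL (M :: Ms) i =
      if i < Ms.length then Term.subL Ms i else if i = Ms.length then M else .var (i - Ms.length - 1) := by
  unfold Term.subL
  by_cases h1 : i < Ms.length
  · simp only [List.length_cons, show i < Ms.length + 1 by omega, dif_pos, h1, if_true]
    have e : Ms.length + 1 - 1 - i = (Ms.length - 1 - i) + 1 := by omega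
    simp only [List.get_eq_getElem, e, List.getElem_cons_succ]
  · by_cases h2 : i = Ms.length
    · subst h2
      simp
    · have h3 : ¬(i < Ms.length + 1) := by omega
      simp only [List.length_cons, h3, dif_neg, not_false_eq_true, h1, if_false, h2]
      congr 1

/-- **Multi-β**: `(λx₁…xₙ.R) M₁ ⋯ Mₙ →* R[subL [M₁,…,Mₙ]]`. [folklore] -/
theorem reduces_apps_lams (n : ℕ) (R : Term) (Ms : List Term) (hlen : Ms.length = n) :
    Reduces ((Term.lams n R).apps Ms) (R.substp (Term.subL Ms)) := by
  induction n generalizing R Ms with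
  | zero =>
    cases Ms with
    | nil =>
      have : R.substp (Term.subL []) = R := (Term.substp_congr (fun i => Term.subL_nil i) R).trans (Term.substp_var R)
      rw [this]; exact Relation.ReflTransGen.refl
    | cons _ _ => simp at hlen
  | succ n ih =>
    cases Ms with
    | nil => simp at hlen
    | cons M Ms =>
      simp only [List.length_cons, Nat.add_right_cancel_iff] at hlen
      simp only [Term.lams, Term.apps_cons]
      have hβ : Red (Term.app (.lam (Term.lams n R)) M) (Term.lams n (R.substp (Term.up^[n] (Term.consSub M)))) := by
        have := Red.beta (Term.lams n R) M
        rwa [Term.subst0_eq_substp, Term.substp_lams] at this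
      refine (Reduces.apps (Relation.ReflTransGen.single hβ) Ms).trans ?_
      have h2 := ih (R.substp (Term.up^[n] (Term.consSub M))) Ms hlen
      rw [Term.substp_substp] at h2
      have e : R.substp (Term.subL (M :: Ms)) = R.substp (fun i => (Term.up^[n] (Term.consSub M) i).substp (Term.subL Ms)) := by
        refine Term.substp_congr (fun i => ?_) R
        rw [Term.up_iterate_consSub, Term.subL_cons, hlen]
        by_cases h1 : i < n
        · simp [h1, Term.substp]
        · by_cases h2 : i = n
          · subst h2
            simp only [lt_irrefl, if_false, if_true]
            rw [Term.substp_rename]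
            refine ((Term.substp_congr (fun j => ?_) M).trans (Term.substp_var M)).symm
            simp [Term.subL, hlen]
          · simp only [h1, h2, if_false, Term.substp, Term.subL, hlen, show ¬(i - 1 < n) by omega, dif_neg,
              not_false_eq_true]
            congr 1; omega
      rw [e]
      exact h2

/-! ### Iterated application, closed words -/

/-- Iterated application `F (F (⋯ (F Z)))`. [folklore] -/
def iterApp (F Z : Term) : ℕ → Term
  | 0 => Z
  | n + 1 => .app F (iterApp F Z n)

/-- Reduction under iterated binders. [folklore] -/
theorem Reduces.lams {M M' : Term} (h : Reduces M M') (n : ℕ) : Reduces (Term.lams n M) (Term.lams n M') := by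
  induction n with
  | zero => exact h
  | succ n ih => exact Reduces.lam ih

/-- Iterated lifting of `subL`. [folklore] -/
theorem Term.up_iterate_subL (Ms : List Term) (d k : ℕ) :
    (Term.up^[d] (Term.subL Ms)) k = if k < d then .var k else (Term.subL Ms (k - d)).rename (fun i => i + d) := by
  induction d generalizing k with
  | zero => simp [Term.rename_id']
  | succ d ih =>
    rw [Function.iterate_succ_apply']
    cases k with
    | zero => simp [Term.up]
    | succ k =>
      rw [Term.up_succ, ih]
      by_cases h : k < d
      · simp [h, show k + 1 < d + 1 by omega, Term.rename]
      · simp only [h, if_false, show ¬(k + 1 < d + 1) by omega, Term.rename_rename, Nat.succ_sub_succ]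
        exact Term.rename_congr (fun i => by show Nat.succ (i + d) = i + (d + 1); omega) _

/-- Words are closed. [folklore] -/
theorem encWord_closed (w : List Bool) (i : ℕ) : ¬(encWord w).FreeIn i := by
  have key : ∀ j, 2 ≤ j → ¬(w.foldr (fun b r => Term.app (.app (.var 1) (STA.encBit b)) r) (.var 0)).FreeIn j := by
    induction w with
    | nil => intro j hj h; simp [Term.FreeIn] at h; omega
    | cons b w ih =>
      intro j hj h
      simp only [List.foldr_cons, Term.FreeIn] at h
      rcases h with (h | h) | h
      · omega
      · cases b <;> simp [STA.encBit, STA.zero, STA.one, Term.FreeIn] at h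
      · exact ih j hj h
  exact key (i + 2) (by omega)


end STA

end Literature.Computability.ImplicitComplexity
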